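import Summits.HubbardSuperconductivity.HubbardSuperconductivity.Theorems.KLProgrammeKLRegimeScaleZeroCovarianceOffSiteDoor

/-!
# Route `KLProgramme`, crux K3 — engine-flow child (stmt-HubbardSuperconductivity-20437), stub (C) at `n = 0`, located item #22a «(C)-SCALE0-PT2»,
# §2e THE SPATIAL ENVELOPE: an off-site entry of the scale-`0` grid covariance decays like `(1+‖z‖_∞)^{-n}` with a `β`-, `M`-, `L`-UNIFORM constant —
# the analytic tail beyond the certified disk, hypothesis-free at the bare frame

Cell gate-hubbard-kl, seat p1 g20.  Per frequency, `…MomentumJets` §6 / `…OffSiteExplicit` give the off-site `L`-uniform decay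
`‖L⁻²Σ_kχ_k(z̄)Ψ¹(ω,e₀(k))‖ ≤ C_n(ω)(1+4ⁿS_n)(1+‖z‖_∞)^{-n}` with `C_n(ω) = O(1/m(ω)²)`; summing `Σ_n 1/(β m(ω_n)²) ≤ 2/Λ` (`…OffSiteWindow` §6) gives
an envelope for the whole frequency series, hence for the window sum = the entry (`…OffSiteDoor`):

* §1 `decayConst_bare_le_envSq` — `C_n(ω) ≤ D₁(n)/m(ω)²`, `D₁(n) = n!·klChi2CauchyTab n·(n+1)!·4·max(1,4/Λ)^{n−1}·(8π)ⁿ/πⁿ`;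
  `norm_freqTerm_le_decay_of_offSite` — `‖F_L(ω)‖ ≤ (1/β)·(D₁(n)/m(ω)²)·(1+4ⁿS_n)·(1+‖z‖_∞)^{-n}` (centred `z`, `2‖z‖_∞ ≤ L`, `z̄ ≠ 0`, `ω ≠ 0`);
* §2 **`tsum_norm_freqTerm_le_decay_of_offSite`** — `Σ'_n ‖F_L(ω_n)‖ ≤ D₁(n)·(2/Λ)·(1+4ⁿS_n)·(1+‖z‖_∞)^{-n}`, and
  `norm_sum_freqTerm_le_decay_of_offSite` — the window sum obeys the same bound (every `M`);
* §3 `two_mul_norm_valMinAbs_le` (the centred representative `z_c = valMinAbs(x₁ − x₀)` has `2‖z_c‖_∞ ≤ L`), and the door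
  **`norm_gridCov_offSite_le_decay`**: for grid points with `x₁ ≠ x₀`, every `n ≥ 4`, every `β > 0`, every `M`, every `L`:
  `‖A((p₁,σ,+),(p₀,σ,−))‖ ≤ D₁(n)·(2/klE0)·(1+4ⁿS_n)·(1+‖z_c‖_∞)^{-n}` — the (2e)-T1 analytic tail of SPEC v2 in Lean (numerically it takes over only at
  `‖z‖ ≳ 10³`, as the SPEC says; the certified disk covers the inside).

Proofs only; no definitions; nothing here asserts (C), any stub of 20437, K3 or superconductivity.  References: BGM 2006 §2.2 fn. 1, §3 (3.2)
[cite: BenfattoGiulianiMastropietro2006]; Glimm–Jaffe 1987 Prop. 7.3.1 [cite: GlimmJaffeQP1987].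
-/

noncomputable section

namespace Summit.HubbardSuperconductivity.HubbardSuperconductivity.Theorems.KLRegimeSplit

set_option linter.dupNamespace false -- summit = problem name (single-conjunct summit), D-0017

open Literature.MathematicalPhysics.QuantumLattice Literature.Probability.LatticeModels Literature.Analysis.FunctionSpaces
open Summit.HubbardSuperconductivity.HubbardSuperconductivity.Theorems.DispersionFlow
open MeasureTheory Set Finset Complex UnitAddTorus Real
open scoped Nat

variable {L M : ℕ} [NeZero L]

/-! ## §1 Per frequency: the off-site decay constant is `O(1/m(ω)²)` -/

/-- The bare-frame off-site decay constant at `c = 1` is `≤ D₁(n)/m(ω)²`, `D₁(n) = n!·klChi2CauchyTab n·(n+1)!·4·max(1,4/Λ)^{n−1}·(8π)ⁿ/πⁿ` (`m ≥ Λ/2`). -/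
theorem decayConst_bare_le_envSq {Λ : ℝ} (hΛ : 0 < Λ) (om : ℝ) (n : ℕ) :
    (n ! * (1 * klChi2CauchyTab n * (n + 1) ! * (2 / max |om| (Λ / 2)) ^ 2 * (max 1 (2 / max |om| (Λ / 2))) ^ (n - 1)) * ((2 * π) * 4) ^ n) / Real.pi ^ n ≤
      (n ! * klChi2CauchyTab n * (n + 1) ! * 4 * (max 1 (4 / Λ)) ^ (n - 1) * ((2 * π) * 4) ^ n / Real.pi ^ n) / max |om| (Λ / 2) ^ 2 := by
  have hm : 0 < max |om| (Λ / 2) := lt_max_of_lt_right (by positivity)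
  have hq : max 1 (2 / max |om| (Λ / 2)) ≤ max 1 (4 / Λ) := by
    refine max_le_max le_rfl ?_
    rw [div_le_div_iff₀ hm hΛ]
    nlinarith [le_max_right |om| (Λ / 2)]
  have htab : 0 ≤ klChi2CauchyTab n := zero_le_one.trans (one_le_klChi2CauchyTab n)
  calc (n ! : ℝ) * (1 * klChi2CauchyTab n * (n + 1) ! * (2 / max |om| (Λ / 2)) ^ 2 * (max 1 (2 / max |om| (Λ / 2))) ^ (n - 1)) * ((2 * π) * 4) ^ n / π ^ n
      ≤ (n ! : ℝ) * (1 * klChi2CauchyTab n * (n + 1) ! * (2 / max |om| (Λ / 2)) ^ 2 * (max 1 (4 / Λ)) ^ (n - 1)) * ((2 * π) * 4) ^ n / π ^ n := by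
        gcongr
    _ = (n ! * klChi2CauchyTab n * (n + 1) ! * 4 * (max 1 (4 / Λ)) ^ (n - 1) * ((2 * π) * 4) ^ n / Real.pi ^ n) / max |om| (Λ / 2) ^ 2 := by
        field_simp
        ring

/-- **Per-frequency off-site decay of the frequency term**: for `0 < β`, `0 < Λ`, `ω ≠ 0`, `n ≥ 4`, a CENTRED off-site `z` (`2‖z‖_∞ ≤ L`, `z̄ ≠ 0`) and every
real `Δτ`: `‖F_L(ω)‖ ≤ (1/β)·(D₁(n)/m(ω)²)·(1+4ⁿS_n)·(1+‖z‖_∞)^{-n}` at the bare frame (`…OffSiteExplicit …_le_inv_pow_offSite_bare_sq_tab` at `c = 1`). -/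
theorem norm_freqTerm_le_decay_of_offSite {β : ℝ} (hβ : 0 < β) {Λ : ℝ} (hΛ : 0 < Λ) (μ : ℝ) {om : ℝ} (hom : om ≠ 0) (Δτ : ℝ) {n : ℕ}
    (hn : 2 * 2 ≤ n) {z : Site 2} (hz : 2 * ‖z‖ ≤ L) (hz0 : Torus.proj L z ≠ 0) :
    ‖((1 / (β * (L : ℝ) ^ 2) : ℝ) : ℂ) ^ 2 * cexp (I * ((om * Δτ : ℝ) : ℂ)) *
        ∑ k, torusChar k (Torus.proj L z) * uvSymbolFn (β * (L : ℝ) ^ 2) Λ (nambuXiCT L μ 0 k) om‖ ≤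
      (1 / β) * (((n ! * klChi2CauchyTab n * (n + 1) ! * 4 * (max 1 (4 / Λ)) ^ (n - 1) * ((2 * π) * 4) ^ n / Real.pi ^ n) / max |om| (Λ / 2) ^ 2) *
        (1 + (4 : ℝ) ^ n * ∑' k : Site 2, ((1 + ‖k‖) ^ n)⁻¹) * ((1 + ‖z‖) ^ n)⁻¹) := by
  rw [freqTerm_eq_torusFourierInv_one hβ, norm_mul, norm_mul, Complex.norm_real, Real.norm_of_nonneg (by positivity)]
  have hexp : ‖cexp (I * ((om * Δτ : ℝ) : ℂ))‖ = 1 := by rw [mul_comm, Complex.norm_exp_ofReal_mul_I]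
  rw [hexp, mul_one]
  refine mul_le_mul_of_nonneg_left ?_ (by positivity)
  have h := norm_torusFourierInv_uvSpatialSample_le_inv_pow_offSite_bare_sq_tab zero_le_one hΛ μ hom hn hz hz0
  refine h.trans ?_
  have hS : 0 ≤ ∑' k : Site 2, ((1 + ‖k‖) ^ n)⁻¹ := tsum_nonneg fun k => by positivity
  exact mul_le_mul_of_nonneg_right (mul_le_mul_of_nonneg_right (decayConst_bare_le_envSq hΛ om n) (by positivity)) (by positivity)

/-! ## §2 Summed over all frequencies, uniformly in `β` -/

/-- **Spatial envelope of the full off-site frequency series**: for `0 < β`, `0 < Λ`, `n ≥ 4`, a centred off-site `z` and every real `Δτ`: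
`Σ'_n ‖F_L(ω_n)‖ ≤ D₁(n)·(2/Λ)·(1+4ⁿS_n)·(1+‖z‖_∞)^{-n}` (summable; `Σ_n 1/(βm(ω_n)²) ≤ 2/Λ`). -/
theorem tsum_norm_freqTerm_le_decay_of_offSite {β : ℝ} (hβ : 0 < β) {Λ : ℝ} (hΛ : 0 < Λ) (μ : ℝ) (Δτ : ℝ) {n : ℕ} (hn : 2 * 2 ≤ n)
    {z : Site 2} (hz : 2 * ‖z‖ ≤ L) (hz0 : Torus.proj L z ≠ 0) :
    Summable (fun j : ℤ => ‖((1 / (β * (L : ℝ) ^ 2) : ℝ) : ℂ) ^ 2 * cexp (I * (((2 * j + 1) * π / β * Δτ : ℝ) : ℂ)) *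
        ∑ k, torusChar k (Torus.proj L z) * uvSymbolFn (β * (L : ℝ) ^ 2) Λ (nambuXiCT L μ 0 k) ((2 * j + 1) * π / β)‖) ∧
    ∑' j : ℤ, ‖((1 / (β * (L : ℝ) ^ 2) : ℝ) : ℂ) ^ 2 * cexp (I * (((2 * j + 1) * π / β * Δτ : ℝ) : ℂ)) *
        ∑ k, torusChar k (Torus.proj L z) * uvSymbolFn (β * (L : ℝ) ^ 2) Λ (nambuXiCT L μ 0 k) ((2 * j + 1) * π / β)‖ ≤
      (n ! * klChi2CauchyTab n * (n + 1) ! * 4 * (max 1 (4 / Λ)) ^ (n - 1) * ((2 * π) * 4) ^ n / Real.pi ^ n) * (2 / Λ) *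
        ((1 + (4 : ℝ) ^ n * ∑' k : Site 2, ((1 + ‖k‖) ^ n)⁻¹) * ((1 + ‖z‖) ^ n)⁻¹) := by
  set D₁ : ℝ := n ! * klChi2CauchyTab n * (n + 1) ! * 4 * (max 1 (4 / Λ)) ^ (n - 1) * ((2 * π) * 4) ^ n / Real.pi ^ n with hD₁
  set W : ℝ := (1 + (4 : ℝ) ^ n * ∑' k : Site 2, ((1 + ‖k‖) ^ n)⁻¹) * ((1 + ‖z‖) ^ n)⁻¹ with hW
  have htab : 0 ≤ klChi2CauchyTab n := zero_le_one.trans (one_le_klChi2CauchyTab n)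
  have hD₁0 : 0 ≤ D₁ := by positivity
  have hS : 0 ≤ ∑' k : Site 2, ((1 + ‖k‖) ^ n)⁻¹ := tsum_nonneg fun k => by positivity
  have hW0 : 0 ≤ W := by positivity
  have hω : ∀ j : ℤ, ((2 * j + 1) * π / β : ℝ) ≠ 0 := fun j => by
    have hodd : (2 * (j : ℝ) + 1) ≠ 0 := by
      have : (2 * (j : ℝ) + 1) = ((2 * j + 1 : ℤ) : ℝ) := by push_cast; ring
      rw [this]; exact_mod_cast (by omega : (2 * j + 1 : ℤ) ≠ 0)
    exact div_ne_zero (mul_ne_zero hodd Real.pi_ne_zero) hβ.ne'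
  obtain ⟨hs, hle⟩ := tsum_int_one_div_beta_mul_max_sq_le hβ (half_pos hΛ)
  set g : ℤ → ℝ := fun j => D₁ * W * (1 / (β * max |(2 * j + 1) * π / β| (Λ / 2) ^ 2)) with hg
  have hgs : Summable g := hs.mul_left _
  have hbound : ∀ j : ℤ, ‖((1 / (β * (L : ℝ) ^ 2) : ℝ) : ℂ) ^ 2 * cexp (I * (((2 * j + 1) * π / β * Δτ : ℝ) : ℂ)) *
      ∑ k, torusChar k (Torus.proj L z) * uvSymbolFn (β * (L : ℝ) ^ 2) Λ (nambuXiCT L μ 0 k) ((2 * j + 1) * π / β)‖ ≤ g j := fun j => by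
    refine (norm_freqTerm_le_decay_of_offSite hβ hΛ μ (hω j) Δτ hn hz hz0).trans (le_of_eq ?_)
    rw [hg, hD₁, hW]
    have hm : 0 < max |(2 * (j : ℝ) + 1) * π / β| (Λ / 2) := lt_max_of_lt_right (by positivity)
    field_simp
  have hfs := Summable.of_nonneg_of_le (fun j => norm_nonneg _) hbound hgs
  refine ⟨hfs, (hfs.tsum_le_tsum hbound hgs).trans ?_⟩
  rw [hg, tsum_mul_left]
  calc D₁ * W * ∑' j : ℤ, 1 / (β * max |(2 * (j : ℝ) + 1) * π / β| (Λ / 2) ^ 2) ≤ D₁ * W * (1 / (Λ / 2)) :=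
        mul_le_mul_of_nonneg_left (by exact_mod_cast hle) (by positivity)
    _ = D₁ * (2 / Λ) * W := by rw [one_div_div]; ring

/-- **The window sum obeys the same envelope** (every `M`): `‖Σ_{i∈MatsubaraIdx M} F_L(ω_i)‖ ≤ D₁(n)·(2/Λ)·(1+4ⁿS_n)·(1+‖z‖_∞)^{-n}`. -/
theorem norm_sum_freqTerm_le_decay_of_offSite {β : ℝ} (hβ : 0 < β) {Λ : ℝ} (hΛ : 0 < Λ) (μ : ℝ) (Δτ : ℝ) {n : ℕ} (hn : 2 * 2 ≤ n)
    {z : Site 2} (hz : 2 * ‖z‖ ≤ L) (hz0 : Torus.proj L z ≠ 0) (M : ℕ) :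
    ‖∑ i : MatsubaraIdx M, ((1 / (β * (L : ℝ) ^ 2) : ℝ) : ℂ) ^ 2 * cexp (I * ((matsubaraFreq β M i * Δτ : ℝ) : ℂ)) *
        ∑ k, torusChar k (Torus.proj L z) * uvSymbolFn (β * (L : ℝ) ^ 2) Λ (nambuXiCT L μ 0 k) (matsubaraFreq β M i)‖ ≤
      (n ! * klChi2CauchyTab n * (n + 1) ! * 4 * (max 1 (4 / Λ)) ^ (n - 1) * ((2 * π) * 4) ^ n / Real.pi ^ n) * (2 / Λ) *
        ((1 + (4 : ℝ) ^ n * ∑' k : Site 2, ((1 + ‖k‖) ^ n)⁻¹) * ((1 + ‖z‖) ^ n)⁻¹) := by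
  obtain ⟨hfs, hle⟩ := tsum_norm_freqTerm_le_decay_of_offSite hβ hΛ μ Δτ hn hz hz0
  set F : ℝ → ℂ := fun om => ((1 / (β * (L : ℝ) ^ 2) : ℝ) : ℂ) ^ 2 * cexp (I * ((om * Δτ : ℝ) : ℂ)) *
    ∑ k, torusChar k (Torus.proj L z) * uvSymbolFn (β * (L : ℝ) ^ 2) Λ (nambuXiCT L μ 0 k) om with hF
  have h1 : ‖∑ i : MatsubaraIdx M, F (matsubaraFreq β M i)‖ ≤ ∑' j : ℤ, ‖F ((2 * j + 1) * π / β)‖ := by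
    rw [sum_matsubaraIdx_freq_eq_sum_Ico β M F]
    refine (norm_sum_le _ _).trans ?_
    exact (hfs.sum_le_tsum (Finset.Ico (-(M : ℤ)) M) (fun j _ => norm_nonneg _))
  simpa only [hF] using h1.trans hle

/-! ## §3 The door: spatial envelope of an off-site entry -/

/-- The centred representative `z_c j = valMinAbs((x₁ − x₀) j)` projects to `x₁ − x₀` and has `2‖z_c‖_∞ ≤ L`. -/
theorem two_mul_norm_valMinAbs_le (u : TorusSite 2 L) :
    Torus.proj L (fun j => (u j).valMinAbs) = u ∧ 2 * ‖(fun j => (u j).valMinAbs : Site 2)‖ ≤ L := by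
  refine ⟨funext fun j => by simp [Literature.Probability.LatticeModels.Torus.proj_apply, ZMod.coe_valMinAbs], ?_⟩
  have h : ‖(fun j => (u j).valMinAbs : Site 2)‖ ≤ (L : ℝ) / 2 := by
    refine (pi_norm_le_iff_of_nonneg (by positivity)).2 fun j => ?_
    rw [Int.norm_eq_abs]
    have hm := ZMod.valMinAbs_mem_Ioc (u j)
    have h2 : |(((u j).valMinAbs : ℤ) : ℝ)| * 2 ≤ L := by
      rw [← Int.cast_abs]
      have : |(u j).valMinAbs| * 2 ≤ (L : ℤ) := by
        have h' : |(u j).valMinAbs * 2| ≤ (L : ℤ) := abs_le.2 ⟨hm.1.le, hm.2⟩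
        rwa [abs_mul, abs_two] at h'
      exact_mod_cast this
    linarith
  linarith

/-- **SPATIAL ENVELOPE DOOR** (bare frame `K = 0`, `Λ = klE0`, hypothesis-free): for grid points `p₁ = (j₁,x₁)`, `p₀ = (j₀,x₀)` with `x₁ ≠ x₀`,
`0 < β`, every `M`, every `L`, every `n ≥ 4`, with `z_c = valMinAbs(x₁ − x₀)` the centred difference:
`‖A((p₁,σ,+),(p₀,σ,−))‖ ≤ D₁(n)·(2/klE0)·(1+4ⁿS_n)·(1+‖z_c‖_∞)^{-n}`, `D₁(n) = n!·klChi2CauchyTab n·(n+1)!·4·max(1,4/klE0)^{n−1}·(8π)ⁿ/πⁿ`. -/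
theorem norm_gridCov_offSite_le_decay {β : ℝ} (hβ : 0 < β) (μ : ℝ) {N : ℕ} {p₁ p₀ : GridPoint L N} (hx : p₁.2 ≠ p₀.2) (σ : Fin 2)
    {n : ℕ} (hn : 2 * 2 ≤ n) :
    ‖((hubbardGridSub L M β N).transpose * hubbardCovAboveCT L M β μ 0 0 klE0 * hubbardGridSub L M β N) ((p₁, σ), 0) ((p₀, σ), 1)‖ ≤
      (n ! * klChi2CauchyTab n * (n + 1) ! * 4 * (max 1 (4 / klE0)) ^ (n - 1) * ((2 * π) * 4) ^ n / Real.pi ^ n) * (2 / klE0) *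
        ((1 + (4 : ℝ) ^ n * ∑' k : Site 2, ((1 + ‖k‖) ^ n)⁻¹) * ((1 + ‖(fun j => ((p₁.2 - p₀.2) j).valMinAbs : Site 2)‖) ^ n)⁻¹) := by
  have hE0 : (0 : ℝ) < klE0 := by norm_num [klE0]
  obtain ⟨hproj, hzc⟩ := two_mul_norm_valMinAbs_le (L := L) (p₁.2 - p₀.2)
  have hz0 : Torus.proj L (fun j => ((p₁.2 - p₀.2) j).valMinAbs) ≠ 0 := by rw [hproj]; exact sub_ne_zero.2 hx
  have key := norm_sum_freqTerm_le_decay_of_offSite hβ hE0 μ (gridTime β N p₁.1 - gridTime β N p₀.1) hn hzc hz0 M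
  rw [hproj] at key
  rw [gridCov_hubbardCovAboveCT_apply_eq_sum_freqTerm hβ μ klE0 p₁ p₀ σ, torusProj_valSub_eq_sub]
  exact key

end Summit.HubbardSuperconductivity.HubbardSuperconductivity.Theorems.KLRegimeSplit

end
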